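import Mathlib
import Summits.Ventures.PercRepro2.PMK5Deg3Kernel

/-!
# The slice certificates of the typed `K₃` base on `K₅ + a₃` of degree 4 — the definitions, parametrised by the attachment quadruple `(x, y, z, w)`
(blind cell PercRepro2, mine-2 g28; the degree-4 rung of `PMK5Deg3Kernel.lean` (mine-2 g27, Theorem 28): one more
`a₃`-edge, three sliced digits, Kronecker base `2^26`)

The graph: `K₅` on `o = 0, a₁ = 1, a₂ = 2, u = 3, b = 4` (edges `0..9`, lexicographic pairs) plus the vertex
`a₃ = 5` joined to `x` (edge `10`), `y` (edge `11`), `z` (edge `12`) and `w` (edge `13`), `x, y, z, w : Fin 5` the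
parameters of the family (the five quadruples `x < y < z < w` are the five degree-4 attachments: `K₆` minus one
edge at `a₃`).  Configurations `ω : Fin 14 → Bool`; connectivity on vertex bitmasks (`nb`, `step`, `reach` — five
closure steps on six vertices — `conn`), all kernel-accelerated.  The marks of the crux functional are
`o = 0, a₁ = 1, a₂ = 2, a₃ = 5, b = 4`; p1's eight-term kernel `K₃` splits on `Q = {a₁ ↮ a₂}` into ten positive and
ten negative products of three `0/1` tables exactly as in `PMK5Deg3Kernel.lean` (`tab`: the nineteen tables).

**Slices.** The profile space is SLICED by the digits `(j₁, j₂, j₃)` of the three `a₃`-edges `11`, `12`, `13`: a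
profile `k : Fin 14 → Fin 4` is `(k', j₁, j₂, j₃)` with `k'` on the eleven remaining edges (`0..10`, the edge `10 = a₃x`
among them), and the class sum at `k` is the sum, over the three-bit splittings of `j₁`, `j₂`, `j₃`
(`Deg3.splits3`, `Deg3.pairs2`), of the eleven-edge triple counts of the tables restricted to edges `11 ↦ ·`,
`12 ↦ ·`, `13 ↦ ·` (`res3`, `ext3`; proved in `Deg4Slices.lean`).  Each slice is a `4^11`-digit certificate (`kPosS`,
`kNegS`, `CertS`), the products grouped by the first factor (`brPosPD`, …) as in the degree-3 file.

**The base.** A slice digit is a sum of at most `10 · 27` counts, each `≤ 3^11`, so `< 10 · 3^14 = 47,829,690`; this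
exceeds `2^24`, so the Kronecker base is `KB = 2^26` here (`mask` reads bit `25` of every base-`KB` digit below
`4^11`), and the eleven-edge Kronecker trees `go` / `goL` of `PMK5Deg3Kernel.lean` are restated for this base
(`Deg4Kron.lean`, `Deg4Digits.lean`, `Deg4Bits.lean` carry the bridge).  The bit-vector tables (`Deg3.bits11`,
`Deg3.idx2`) and the splittings are the degree-3 ones, by name.

**Table literals.** The restricted tables enter the slice numbers as `2048`-bit LITERALS
`L : Fin 19 → Bool → Bool → Bool → ℕ` (`KL`, `kronL` / `goL`), and one kernel theorem per restriction certifies the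
literals against the tables (`LitOK`).  A quadruple's certificate is `LitOK x y z w L` plus `Cert L` (the sixty-four
`CertS L j₁ j₂ j₃`); `Deg4Typed.HCov_deg4` turns it into row 2′TRI and (HCOV) on `K₅ + {a₃x, a₃y, a₃z, a₃w}` for
every weight vector.  No `native_decide`, no data file beyond the table literals, which the kernel itself certifies.
-/

namespace Summit.Ventures.PercRepro2

namespace Deg4

/-! ## The graph `K₅ + {a₃x, a₃y, a₃z, a₃w}` and bitmask connectivity on six vertices -/

/-- First endpoint of edge `e` (lexicographic pairs of `K₅`, then `a₃x`, `a₃y`, `a₃z`, `a₃w`: the attachment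
quadruple `x, y, z, w : Fin 5` is the parameter of the family). -/
def ea (x y z w : Fin 5) : Fin 14 → ℕ
  | 0 => 0 | 1 => 0 | 2 => 0 | 3 => 0 | 4 => 1 | 5 => 1 | 6 => 1 | 7 => 2 | 8 => 2 | 9 => 3 | 10 => x | 11 => y
  | 12 => z | 13 => w

/-- Second endpoint of edge `e` (the four attachment edges end at `a₃ = 5`). -/
def eb : Fin 14 → ℕ
  | 0 => 1 | 1 => 2 | 2 => 3 | 3 => 4 | 4 => 2 | 5 => 3 | 6 => 4 | 7 => 3 | 8 => 4 | 9 => 4 | 10 => 5 | 11 => 5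
  | 12 => 5 | 13 => 5

/-- The neighbour bitmask of the vertex `u` in the open subgraph of `ω`. -/
def nb (x y z w : Fin 5) (ω : Fin 14 → Bool) (u : ℕ) : ℕ :=
  (List.finRange 14).foldl (fun acc e =>
    if ω e then
      (if ea x y z w e = u then acc ||| (1 <<< eb e) else if eb e = u then acc ||| (1 <<< ea x y z w e) else acc)
    else acc) 0

/-- One closure step on a vertex bitmask: add the open neighbours of every vertex of `R`. -/
def step (x y z w : Fin 5) (ω : Fin 14 → Bool) (R : ℕ) : ℕ :=
  (List.range 6).foldl (fun acc v => if R.testBit v then acc ||| nb x y z w ω v else acc) R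

/-- The vertices reached from `u` (five steps suffice on six vertices). -/
def reach (x y z w : Fin 5) (ω : Fin 14 → Bool) (u : ℕ) : ℕ :=
  step x y z w ω (step x y z w ω (step x y z w ω (step x y z w ω (step x y z w ω (1 <<< u)))))

/-- Computable connectivity `u ↔ v` in the open subgraph of `ω`. -/
def conn (x y z w : Fin 5) (ω : Fin 14 → Bool) (u v : ℕ) : Bool := (reach x y z w ω u).testBit v

/-! ## The side tables (marks `o = 0, a₁ = 1, a₂ = 2, a₃ = 5, b = 4`) -/

/-- `Q = {a₁ ↮ a₂}`. -/
def tQ (x y z w : Fin 5) (ω : Fin 14 → Bool) : Bool := !conn x y z w ω 1 2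
/-- `L_v = {v ∈ C₁}`: `v` joined to `a₁ = 1`. -/
def tL (x y z w : Fin 5) (v : ℕ) (ω : Fin 14 → Bool) : Bool := conn x y z w ω 1 v
/-- `H_v = {v ∈ C₂}`: `v` joined to `a₂ = 2`. -/
def tH (x y z w : Fin 5) (v : ℕ) (ω : Fin 14 → Bool) : Bool := conn x y z w ω 2 v
/-- `U_v = {v ∈ C₁ ∪ C₂}`. -/
def tU (x y z w : Fin 5) (v : ℕ) (ω : Fin 14 → Bool) : Bool := tL x y z w v ω || tH x y z w v ω
/-- `u` and `v` on the same side: the positive part of `σ_u σ_v`. -/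
def tSame (x y z w : Fin 5) (u v : ℕ) (ω : Fin 14 → Bool) : Bool :=
  (tL x y z w u ω && tL x y z w v ω) || (tH x y z w u ω && tH x y z w v ω)
/-- `u` and `v` on opposite sides: the negative part of `σ_u σ_v`. -/
def tOpp (x y z w : Fin 5) (u v : ℕ) (ω : Fin 14 → Bool) : Bool :=
  (tL x y z w u ω && tH x y z w v ω) || (tH x y z w u ω && tL x y z w v ω)
/-- `PD = Q ∩ {a₃ ∉ C₁ ∪ C₂}`. -/
def tPD (x y z w : Fin 5) (ω : Fin 14 → Bool) : Bool := tQ x y z w ω && !tL x y z w 5 ω && !tH x y z w 5 ω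
/-- `PD ∩ {o ∈ C₁ ∪ C₂}` (`f₃`). -/
def tPDoU (x y z w : Fin 5) (ω : Fin 14 → Bool) : Bool := tPD x y z w ω && tU x y z w 0 ω

/-! ## The tables of the twelve functions -/

/-- `f₄⁺ = 1_Q 1_{o, b same side}`. -/
def t4p (x y z w : Fin 5) (ω : Fin 14 → Bool) : Bool := tQ x y z w ω && tSame x y z w 0 4 ω
/-- `f₄⁻ = 1_Q 1_{o, b opposite}`. -/
def t4m (x y z w : Fin 5) (ω : Fin 14 → Bool) : Bool := tQ x y z w ω && tOpp x y z w 0 4 ω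
/-- `f₅⁺ = 1_Q 1_{a₃, b same side}`. -/
def t5p (x y z w : Fin 5) (ω : Fin 14 → Bool) : Bool := tQ x y z w ω && tSame x y z w 5 4 ω
/-- `f₅⁻ = 1_Q 1_{a₃, b opposite}`. -/
def t5m (x y z w : Fin 5) (ω : Fin 14 → Bool) : Bool := tQ x y z w ω && tOpp x y z w 5 4 ω
/-- `f₆⁺ = 1_Q 1_{o∈U} 1_{a₃, b same side}`. -/
def t6p (x y z w : Fin 5) (ω : Fin 14 → Bool) : Bool := tQ x y z w ω && tU x y z w 0 ω && tSame x y z w 5 4 ω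
/-- `f₆⁻ = 1_Q 1_{o∈U} 1_{a₃, b opposite}`. -/
def t6m (x y z w : Fin 5) (ω : Fin 14 → Bool) : Bool := tQ x y z w ω && tU x y z w 0 ω && tOpp x y z w 5 4 ω
/-- `f₇⁺` at `v`: `1_Q 1_{v∈C₁}` (`f₇` at `b = 4`, `f₈` at `o = 0`, `f₉` at `a₃ = 5`). -/
def t7p (x y z w : Fin 5) (v : ℕ) (ω : Fin 14 → Bool) : Bool := tQ x y z w ω && tL x y z w v ω
/-- `f₇⁻` at `v`: `1_Q 1_{v∈C₂}`. -/
def t7m (x y z w : Fin 5) (v : ℕ) (ω : Fin 14 → Bool) : Bool := tQ x y z w ω && tH x y z w v ω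
/-- `f₁₀⁺ = 1_Q 1_{a₃∈C₁} 1_{o∈U}`. -/
def t10p (x y z w : Fin 5) (ω : Fin 14 → Bool) : Bool := tQ x y z w ω && tL x y z w 5 ω && tU x y z w 0 ω
/-- `f₁₀⁻ = 1_Q 1_{a₃∈C₂} 1_{o∈U}`. -/
def t10m (x y z w : Fin 5) (ω : Fin 14 → Bool) : Bool := tQ x y z w ω && tH x y z w 5 ω && tU x y z w 0 ω
/-- `f₁₁ = 1_PD 1_{o∈U} 1_{b∈U}`. -/
def t11 (x y z w : Fin 5) (ω : Fin 14 → Bool) : Bool := tPD x y z w ω && tU x y z w 0 ω && tU x y z w 4 ω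
/-- `f₁₂ = 1_PD 1_{b∈U}`. -/
def t12 (x y z w : Fin 5) (ω : Fin 14 → Bool) : Bool := tPD x y z w ω && tU x y z w 4 ω

/-! ## The nineteen tables as a family -/

/-- The nineteen `0/1` tables of the split kernel, indexed: `0 Q, 1 PD, 2 PDoU, 3 t4p, 4 t4m, 5 t5p, 6 t5m, 7 t6p,
8 t6m, 9 t7p4, 10 t7m4, 11 t7p0, 12 t7m0, 13 t7p5, 14 t7m5, 15 t10p, 16 t10m, 17 t11, 18 t12`. -/
def tab (x y z w : Fin 5) : Fin 19 → (Fin 14 → Bool) → Bool :=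
  ![tQ x y z w, tPD x y z w, tPDoU x y z w, t4p x y z w, t4m x y z w, t5p x y z w, t5m x y z w, t6p x y z w,
    t6m x y z w, t7p x y z w 4, t7m x y z w 4, t7p x y z w 0, t7m x y z w 0, t7p x y z w 5, t7m x y z w 5,
    t10p x y z w, t10m x y z w, t11 x y z w, t12 x y z w]

/-! ## Restriction of the three `a₃`-edges `11`, `12`, `13`: tables on the eleven remaining edges -/

/-- Extend an eleven-edge configuration by the states `a` of edge `11`, `b` of edge `12` and `c` of edge `13`. -/
def ext3 (ω : Fin 11 → Bool) (a b c : Bool) : Fin 14 → Bool :=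
  fun e => if h : (e : ℕ) < 11 then ω ⟨e, h⟩ else if (e : ℕ) = 11 then a else if (e : ℕ) = 12 then b else c

/-- The restriction of a fourteen-edge table to the eleven-edge configurations, edges `11`, `12`, `13` fixed. -/
def res3 (T : (Fin 14 → Bool) → Bool) (a b c : Bool) : (Fin 11 → Bool) → Bool := fun ω => T (ext3 ω a b c)

/-- **The table literals of a quadruple are correct**: `L i a b c` is the bit vector (`Deg3.bits11`) of the
restriction of the `i`-th table of the quadruple to edges `11 ↦ a`, `12 ↦ b`, `13 ↦ c`. -/
def LitOK (x y z w : Fin 5) (L : Fin 19 → Bool → Bool → Bool → ℕ) : Prop :=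
  ∀ (i : Fin 19) (a b c : Bool), L i a b c = Deg3.bits11 (res3 (tab x y z w i) a b c)

/-! ## Kronecker numbers on eleven edges in the base `2^26`, from a bit vector -/

/-- The Kronecker base `2^26` (a slice digit is a sum of at most `270` counts `≤ 3^11`, so `< 2^26`). -/
def KB : ℕ := 2 ^ 26

/-- The Kronecker encoding of a Boolean table on the eleven-edge configurations, as a finite sum. -/
def kronSum (T : (Fin 11 → Bool) → Bool) : ℕ := ∑ ω, (T ω).toNat * KB ^ Deg3.idx ω

/-- The same number by a binary tree over the edges `10, 9, …, 0` (`go T n ω` sums over the states of the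
edges `< n`, the others fixed by `ω`): `go T (n+1) ω = go T n ω[n ↦ 0] + KB^{4^n} · go T n ω[n ↦ 1]`. -/
def go (T : (Fin 11 → Bool) → Bool) : ℕ → (Fin 11 → Bool) → ℕ
  | 0, ω => (T ω).toNat
  | n + 1, ω => go T n (Function.update ω (Fin.ofNat 11 n) false) +
      KB ^ (4 ^ n) * go T n (Function.update ω (Fin.ofNat 11 n) true)

/-- The Kronecker encoding, kernel form: `kron T = go T 11 (fun _ => false)`. -/
def kron (T : (Fin 11 → Bool) → Bool) : ℕ := go T 11 (fun _ => false)

/-- **The Kronecker number of a bit-vector table, by the index-carrying tree**: `goL L n i` sums, over the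
states of the edges `< n` (the bits of `i` carry the fixed ones), `[bit (i + idx2 s) of L] · KB^{idx s}` —
a leaf is one `Nat.testBit`. -/
def goL (L : ℕ) : ℕ → ℕ → ℕ
  | 0, i => (L.testBit i).toNat
  | n + 1, i => goL L n i + KB ^ (4 ^ n) * goL L n (i + 2 ^ n)

/-- The Kronecker number of the table with bit vector `L`. -/
def kronL (L : ℕ) : ℕ := goL L 11 0

/-- The mask: bit `25` of every base-`KB` digit below `4^11`. -/
def mask : ℕ := 2 ^ 25 * ((KB ^ (4 ^ 11) - 1) / (KB - 1))

/-! ## The slices: profile digits `j₁`, `j₂`, `j₃` of the edges `11`, `12`, `13` -/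

/-- The Kronecker number of the `i`-th table restricted to `(a, b, c)`, from the literals `L`. -/
def KL (L : Fin 19 → Bool → Bool → Bool → ℕ) (i : Fin 19) (a b c : Bool) : ℕ := kronL (L i a b c)

/-- The Kronecker number of the two-table sum `S₁ = t4p + t6m` of the positive `PD`-group, restricted. -/
def S1 (L : Fin 19 → Bool → Bool → Bool → ℕ) (a b c : Bool) : ℕ := KL L 3 a b c + KL L 8 a b c
/-- `S₂ = t7m0 + t10p` (positive `PD`-group), restricted. -/
def S2 (L : Fin 19 → Bool → Bool → Bool → ℕ) (a b c : Bool) : ℕ := KL L 12 a b c + KL L 15 a b c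
/-- `S₃ = t7p0 + t10m` (positive `PD`-group), restricted. -/
def S3 (L : Fin 19 → Bool → Bool → Bool → ℕ) (a b c : Bool) : ℕ := KL L 11 a b c + KL L 16 a b c

/-- `S₁′ = t4m + t6p + t11` (negative `PD`-group), restricted. -/
def S1' (L : Fin 19 → Bool → Bool → Bool → ℕ) (a b c : Bool) : ℕ :=
  KL L 4 a b c + KL L 7 a b c + KL L 17 a b c
/-- `S₂′ = t7p0 + t10m` (negative `PD`-group), restricted. -/
def S2' (L : Fin 19 → Bool → Bool → Bool → ℕ) (a b c : Bool) : ℕ := KL L 11 a b c + KL L 16 a b c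
/-- `S₃′ = t7m0 + t10p` (negative `PD`-group), restricted. -/
def S3' (L : Fin 19 → Bool → Bool → Bool → ℕ) (a b c : Bool) : ℕ := KL L 12 a b c + KL L 15 a b c

/-- The inner sum of a group at the first factor's bits `(a₁, a₂, a₃)`: the bracket `f` (of the second and third
factors' bits `(b₁, c₁)`, `(b₂, c₂)`, `(b₃, c₃)` of the edges `11`, `12`, `13`) summed over the completions of
`(a₁, a₂, a₃)` to the digits `(j₁, j₂, j₃)` — edge `13` outermost, edge `11` innermost. -/
def inner (j₁ j₂ j₃ : ℕ) (a₁ a₂ a₃ : Bool) (f : Bool × Bool → Bool × Bool → Bool × Bool → ℕ) : ℕ :=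
  ((Deg3.pairs2 j₃ a₃).map fun bc₃ => ((Deg3.pairs2 j₂ a₂).map fun bc₂ =>
    ((Deg3.pairs2 j₁ a₁).map fun bc₁ => f bc₁ bc₂ bc₃).sum).sum).sum

/-- The positive `PD`-group bracket: `Q_b S₁_c + t7p4_b S₂_c + t7m4_b S₃_c` (monomials 1, 3, 4, 8, 5, 9). -/
def brPosPD (L : Fin 19 → Bool → Bool → Bool → ℕ) (bc₁ bc₂ bc₃ : Bool × Bool) : ℕ :=
  KL L 0 bc₁.1 bc₂.1 bc₃.1 * S1 L bc₁.2 bc₂.2 bc₃.2 + KL L 9 bc₁.1 bc₂.1 bc₃.1 * S2 L bc₁.2 bc₂.2 bc₃.2 +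
    KL L 10 bc₁.1 bc₂.1 bc₃.1 * S3 L bc₁.2 bc₂.2 bc₃.2

/-- The positive `PDoU`-group bracket: `t7p4_b t7m5_c + t7m4_b t7p5_c` (monomials 6, 7). -/
def brPosPDoU (L : Fin 19 → Bool → Bool → Bool → ℕ) (bc₁ bc₂ bc₃ : Bool × Bool) : ℕ :=
  KL L 9 bc₁.1 bc₂.1 bc₃.1 * KL L 14 bc₁.2 bc₂.2 bc₃.2 + KL L 10 bc₁.1 bc₂.1 bc₃.1 * KL L 13 bc₁.2 bc₂.2 bc₃.2

/-- The positive `Q`-group bracket: `PDoU_b t5p_c + t12_b PDoU_c` (monomials 2, 10; factor orders kept). -/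
def brPosQ (L : Fin 19 → Bool → Bool → Bool → ℕ) (bc₁ bc₂ bc₃ : Bool × Bool) : ℕ :=
  KL L 2 bc₁.1 bc₂.1 bc₃.1 * KL L 5 bc₁.2 bc₂.2 bc₃.2 + KL L 18 bc₁.1 bc₂.1 bc₃.1 * KL L 2 bc₁.2 bc₂.2 bc₃.2

/-- The negative `PD`-group bracket: `Q_b S₁′_c + t7p4_b S₂′_c + t7m4_b S₃′_c` (monomials 1′, 3′, 10′, 4′, 8′, 5′, 9′). -/
def brNegPD (L : Fin 19 → Bool → Bool → Bool → ℕ) (bc₁ bc₂ bc₃ : Bool × Bool) : ℕ :=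
  KL L 0 bc₁.1 bc₂.1 bc₃.1 * S1' L bc₁.2 bc₂.2 bc₃.2 + KL L 9 bc₁.1 bc₂.1 bc₃.1 * S2' L bc₁.2 bc₂.2 bc₃.2 +
    KL L 10 bc₁.1 bc₂.1 bc₃.1 * S3' L bc₁.2 bc₂.2 bc₃.2

/-- The negative `PDoU`-group bracket: `t7p4_b t7p5_c + t7m4_b t7m5_c` (monomials 6′, 7′). -/
def brNegPDoU (L : Fin 19 → Bool → Bool → Bool → ℕ) (bc₁ bc₂ bc₃ : Bool × Bool) : ℕ :=
  KL L 9 bc₁.1 bc₂.1 bc₃.1 * KL L 13 bc₁.2 bc₂.2 bc₃.2 + KL L 10 bc₁.1 bc₂.1 bc₃.1 * KL L 14 bc₁.2 bc₂.2 bc₃.2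

/-- The negative `Q`-group bracket: `PDoU_b t5m_c` (monomial 2′). -/
def brNegQ (L : Fin 19 → Bool → Bool → Bool → ℕ) (bc₁ bc₂ bc₃ : Bool × Bool) : ℕ :=
  KL L 2 bc₁.1 bc₂.1 bc₃.1 * KL L 6 bc₁.2 bc₂.2 bc₃.2

/-- **The positive slice number**: the Kronecker number of the positive counts of `K₃` at the profiles whose
digits on the edges `11`, `12`, `13` are `j₁`, `j₂`, `j₃`, grouped by the first factor:
`Σ_{a₃ a₂ a₁} PD_{a} · inner brPosPD + PDoU_{a} · inner brPosPDoU + Q_{a} · inner brPosQ`. -/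
def kPosS (L : Fin 19 → Bool → Bool → Bool → ℕ) (j₁ j₂ j₃ : ℕ) : ℕ :=
  (Deg3.bools.map fun a₃ => (Deg3.bools.map fun a₂ => (Deg3.bools.map fun a₁ =>
    KL L 1 a₁ a₂ a₃ * inner j₁ j₂ j₃ a₁ a₂ a₃ (brPosPD L) +
      KL L 2 a₁ a₂ a₃ * inner j₁ j₂ j₃ a₁ a₂ a₃ (brPosPDoU L) +
      KL L 0 a₁ a₂ a₃ * inner j₁ j₂ j₃ a₁ a₂ a₃ (brPosQ L)).sum).sum).sum

/-- **The negative slice number**, grouped the same way. -/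
def kNegS (L : Fin 19 → Bool → Bool → Bool → ℕ) (j₁ j₂ j₃ : ℕ) : ℕ :=
  (Deg3.bools.map fun a₃ => (Deg3.bools.map fun a₂ => (Deg3.bools.map fun a₁ =>
    KL L 1 a₁ a₂ a₃ * inner j₁ j₂ j₃ a₁ a₂ a₃ (brNegPD L) +
      KL L 2 a₁ a₂ a₃ * inner j₁ j₂ j₃ a₁ a₂ a₃ (brNegPDoU L) +
      KL L 0 a₁ a₂ a₃ * inner j₁ j₂ j₃ a₁ a₂ a₃ (brNegQ L)).sum).sum).sum

/-- **The slice certificate shape**: `kNegS ≤ kPosS` and the two mask tests (no borrow anywhere, digits of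
`kNegS` below `2^25`). -/
def CertS (L : Fin 19 → Bool → Bool → Bool → ℕ) (j₁ j₂ j₃ : ℕ) : Prop :=
  kNegS L j₁ j₂ j₃ ≤ kPosS L j₁ j₂ j₃ ∧ Nat.land (kPosS L j₁ j₂ j₃ - kNegS L j₁ j₂ j₃) mask = 0 ∧
    Nat.land (kNegS L j₁ j₂ j₃) mask = 0

/-- **All sixty-four slices**: the certificate of a table family. -/
def Cert (L : Fin 19 → Bool → Bool → Bool → ℕ) : Prop := ∀ j₁ j₂ j₃ : Fin 4, CertS L j₁ j₂ j₃

end Deg4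

end Summit.Ventures.PercRepro2
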